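import Literature.NumberTheory.Automorphic.PicardCMUniverse
import HarnessLib

/-!
# REVIEW-RUNBOOK sanity lemmas — the dimension `Var.dim` of a CM code is a genuine `finrank`
# (clients `pub-hccm`, `pub-hodgecm2`, `pub-hodgecm` of the ops review-runbook generator; §2 card `Var.dim`)

`Literature.NumberTheory.Automorphic.PicardCM.Var.dim (cm c) = Module.finrank ℚ c.E / 2` for a CM code `c` (`c.E` a
subfield of `ℂ` carrying a `NumberField` instance, `CMCode.isNumberField`).  Mathlib's `Module.finrank` is the default
`0` for a space that is not finite-dimensional; a number field IS finite-dimensional over `ℚ`, so the dimension of the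
CM abelian variety of `c` is the genuine `[E:ℚ]/2`.  The other constructors (`pms`, `proj`, `prod`) involve no totalised
operation.

Review evidence only (topic module, closes no item); no definitions, no `sorry`, standard axioms.
-/

namespace Summit.HodgeConjecture.HodgeCM.Runbook

open Literature.NumberTheory.Automorphic.PicardCM

/-- (c) **The CM field of a CM code is finite-dimensional over `ℚ`** (it is a number field): the `Module.finrank ℚ c.E`
inside `Var.dim (cm c)` is the genuine degree `[E:ℚ]`. [folklore] -/
theorem dim_cmField_finite (c : CMCode) : Module.Finite ℚ c.E :=
  inferInstance

/-- The same fact spelled `FiniteDimensional`. [folklore] -/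
theorem dim_cmField_finiteDimensional (c : CMCode) : FiniteDimensional ℚ c.E :=
  inferInstance

/-- Hence the degree is positive: `0 < [E:ℚ]` (a field is a non-trivial `ℚ`-space). [folklore] -/
theorem finrank_cmField_pos (c : CMCode) : 0 < Module.finrank ℚ c.E :=
  Module.finrank_pos

/-- (a) `Var.dim` on the constructors without a `finrank`: `dim (pms c) = 2`, `dim (proj n) = n`,
`dim (prod v w) = dim v + dim w` (by definition). [folklore] -/
theorem dim_pms_proj_prod (c : PicardCode) (n : ℕ) (v w : Var) :
    (Var.pms c).dim = 2 ∧ (Var.proj n).dim = n ∧ (Var.prod v w).dim = v.dim + w.dim :=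
  ⟨rfl, rfl, rfl⟩

end Summit.HodgeConjecture.HodgeCM.Runbook
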